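import Summits.NavierStokesRegularity.NavierStokesRegularity.Theorems.ScenarioCensusSteady
import Summits.NavierStokesRegularity.NavierStokesRegularity.Theorems.ScenarioCensusPeriodicSlabLiouville
import HarnessLib

/-!
# Blow-up scenario census, block S: row S7d is EXCLUDED-IN-TREE (leaf closer)

Cell `pub/ns-census` (director-ns KEY req102, D-0154 (A)), typer seat `ns-census-typer-2` (generation 6).
Census row S7d (`ScenarioCensusSteady.lean`, Appendix 4: steady · NO symmetry · bounded smooth steady
Navier–Stokes flow on `ℝ³`, `ν > 0`, axially `L`-periodic, `sup ‖U‖ < 2πν/L` ⇒ constant; the second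
conjunct of the Literature fact `BangGuiWangXie2025_periodicSlab_liouville` = Bang–Gui–Wang–Xie,
J. Fluid Mech. 1005 (2025) A6, Thm 1.4 (d)) is closed BY NAME by the tree theorem
`ScenarioCensus.PeriodicSlab.periodicSlab_liouville_small` (`ScenarioCensusPeriodicSlabLiouville.lean`,
with its chain `…PeriodicSlab{Tools,Regularity,Energy,Window,Bounds,Terms,Estimate}.lean`). This leaf
file only composes the two (kept out of both so that neither the row file nor the proof chain imports
the other). The composite row `Row_S7` (cases (a)–(d)) stays PRINT. No summit statement is proved.
-/

-- the summit and its single problem share the name (D-0017 nested layout)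
set_option linter.dupNamespace false

noncomputable section

namespace Summit.NavierStokesRegularity.NavierStokesRegularity.Theorems.ScenarioCensus

/-- **Census row S7d is EXCLUDED-IN-TREE**: case (d) of Bang–Gui–Wang–Xie 2025, Thm 1.4 — a
bounded smooth steady Navier–Stokes flow on `ℝ³`, axially `L`-periodic, with `sup ‖U‖ < 2πν/L`,
is a constant vector — i.e. `Row_S7d`, by `PeriodicSlab.periodicSlab_liouville_small` (Wirtinger in
`x₃` with the sharp constant, dyadic Saint-Venant estimate, and the tree's `2½`-dimensional
Liouville theorem `Literature.Analysis.FluidPDE.apply_eq_apply_zero_of_invariant_along`). -/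
theorem row_S7d_excluded : Row_S7d :=
  fun _ν hν _L hL _U _P hUP hU hP _ hper hsmall =>
    PeriodicSlab.periodicSlab_liouville_small hν hL hUP hU hP hsmall hper

end Summit.NavierStokesRegularity.NavierStokesRegularity.Theorems.ScenarioCensus

end
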